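import Summits.Ventures.PercRepro.ProfilePointedCircuitClassesFiveTop
import Summits.Ventures.PercRepro.ProfilePointedCircuitClassesInOutTenE

/-!
# PercRepro — THE CO-RANK-6 TOP THRESHOLD AT NULLITY 5 ON TWELVE POINTS, UNCONDITIONALLY (p5, gen 40;
`proofs/P5-GM1.md` §59 ADDENDUM 2)

The nullity-5 chain of `…FiveTwo` / `…FiveTop` carries the per-point in–out inequality at nullity `4` as the hypothesis
`hio : InOutBottomFour α`, applied once — to the minor `N° := N ／ x ∖ w₁` (nullity `4`, rank `ρ(E) − 1`, `n − 2` points)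
at the point `w₂`, in the class `#C = 2`.  On `#E = 12`, `ρ(E) = 7` that minor has `10` points and rank `6`, where the
inequality is now a theorem at every point (`inCount_four_le_outCount_five_of_card_ten`).  This file re-runs the chain
with that instance in place of `hio` (the class-`2` proof is the one of `…FiveTwo`, verbatim but for the last line):

THIS FILE: `gammaC_five_le_of_card_eq_two_of_twelve` (the class `#C = 2` on twelve points).  The chain
(`…TwelveTop`): `gammaC_five_le_of_nullity_five_of_twelve`, `capCount_five_le_of_twelve`,
`outCount_five_le_inCount_six_of_twelve`, **`biIndep_step_five_of_twelve`** (`7·P_5 ≤ 6·P_6` on `#E = 12`, `ρ(E) = 7`)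
and **`thresholdIneq_six_top_of_twelve`** (the co-rank-`6` top threshold at nullity `5` on twelve points).
-/

open scoped Matroid

namespace PercRepro.Cogirth

open Finset ThmH Skew Shadow Profile

variable {α : Type} [DecidableEq α] {N : Matroid α} [N.Finite]

section Twelve

/-- **THE CLASS `#C = 2` AT NULLITY 5 ON TWELVE POINTS** — the proof of `gammaC_five_le_of_card_eq_two_of_inout`
with the `n = 10` theorem in place of the conjecture: the class of the triangle `{x, w₁, w₂}` at the level `k` is
`{W ∈ BI_k : w₁, w₂ ∈ W, x ∉ W} ≅ {X ∈ BI_{k−1}(N ／ x ∖ w₁) : w₂ ∈ X}`, so `γ_C(5) ≤ γ_C(n − 6)` is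
`in_4(w₂) ≤ in_{n−7}(w₂) = out_5(w₂)` on the `10`-point minor `N ／ x ∖ w₁` of rank `6`. -/
theorem gammaC_five_le_of_card_eq_two_of_twelve
    (hn : (gr N).card = rk N (gr N) + 5) (hR7 : rk N (gr N) = 7)
    (x : α) {C : Finset α} (hC : C.card = 2) : gammaC N 5 x C ≤ gammaC N ((gr N).card - 6) x C := by
  have hR : 7 ≤ rk N (gr N) := hR7.ge
  obtain ⟨w₁, w₂, hw12, rfl⟩ := card_eq_two.1 hC
  unfold gammaC
  rcases ((biIndepSets N 5).filter (fun W => x ∉ W ∧ x ∈ clF N W ∧ fundC N W x = {w₁, w₂})).eq_empty_or_nonempty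
    with hemp | ⟨W₀, hW₀⟩
  · rw [hemp, card_empty]
    exact Nat.zero_le _
  rw [mem_filter, mem_biIndepSets] at hW₀
  obtain ⟨⟨hW₀g, hW₀card, hW₀rk, hW₀compl⟩, hxW₀, hxcl₀, hfund₀⟩ := hW₀
  have hCW₀ : {w₁, w₂} ⊆ W₀ := hfund₀ ▸ fundC_subset W₀ x
  have hw₁W₀ : w₁ ∈ W₀ := hCW₀ (mem_insert_self _ _)
  have hw₂W₀ : w₂ ∈ W₀ := hCW₀ (mem_insert_of_mem (mem_singleton_self _))
  have hw₁g : w₁ ∈ gr N := hW₀g hw₁W₀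
  have hw₂g : w₂ ∈ gr N := hW₀g hw₂W₀
  have hxg : x ∈ gr N := clF_subset_gr W₀ hxcl₀
  have hxw₁ : x ≠ w₁ := fun h => hxW₀ (h ▸ hw₁W₀)
  have hxw₂ : x ≠ w₂ := fun h => hxW₀ (h ▸ hw₂W₀)
  -- the triangle `{x, w₁, w₂}`: `x ∈ cl{w₁, w₂}`, `x ∉ cl{w₂}`, `x ∉ cl{w₁}`
  have hxcl12 : x ∈ clF N {w₁, w₂} := by
    have h := mem_clF_sdiff_of_forall_notMem_fundC hxg hW₀g hW₀rk hxcl₀ (W₀ \ {w₁, w₂}) sdiff_subset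
      (fun w hw => by rw [hfund₀]; exact (mem_sdiff.1 hw).2)
    rwa [Finset.sdiff_sdiff_eq_self hCW₀] at h
  have hxn2 : x ∉ clF N {w₂} := by
    intro h
    have hw₁f : w₁ ∈ fundC N W₀ x := by rw [hfund₀]; exact mem_insert_self _ _
    unfold fundC at hw₁f
    rw [mem_filter] at hw₁f
    exact hw₁f.2 (mem_clF_of_subset (singleton_subset_iff.2 (mem_erase.2 ⟨hw12.symm, hw₂W₀⟩)) h)
  have hxn1 : x ∉ clF N {w₁} := by
    intro h
    have hw₂f : w₂ ∈ fundC N W₀ x := by rw [hfund₀]; exact mem_insert_of_mem (mem_singleton_self _)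
    unfold fundC at hw₂f
    rw [mem_filter] at hw₂f
    exact hw₂f.2 (mem_clF_of_subset (singleton_subset_iff.2 (mem_erase.2 ⟨hw12, hw₁W₀⟩)) h)
  have hr12 : rk N {w₁, w₂} = 2 := by
    have h := rk_eq_card_of_subset_of_rk_eq_card hCW₀ hW₀rk
    rwa [card_pair hw12] at h
  have hr1 : rk N {w₁} = 1 := by
    have h := rk_eq_card_of_subset_of_rk_eq_card (singleton_subset_iff.2 hw₁W₀) hW₀rk
    rwa [card_singleton] at h
  have hr2 : rk N {w₂} = 1 := by
    have h := rk_eq_card_of_subset_of_rk_eq_card (singleton_subset_iff.2 hw₂W₀) hW₀rk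
    rwa [card_singleton] at h
  have hrx12 : rk N (insert x {w₁, w₂}) = 2 := by
    rw [rk_insert_eq hxg (insert_subset hw₁g (singleton_subset_iff.2 hw₂g)), if_pos hxcl12, hr12]
  have hrx2 : rk N (insert x {w₂}) = 2 := by
    rw [rk_insert_eq hxg (singleton_subset_iff.2 hw₂g), if_neg hxn2, hr2]
  have hrx1 : rk N (insert x {w₁}) = 2 := by
    rw [rk_insert_eq hxg (singleton_subset_iff.2 hw₁g), if_neg hxn1, hr1]
  -- `w₁ ∈ cl{x, w₂}` and `w₂ ∈ cl{x, w₁}`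
  have hw₁cl : w₁ ∈ clF N (insert x {w₂}) := by
    by_contra h
    have e : insert w₁ (insert x ({w₂} : Finset α)) = insert x ({w₁, w₂} : Finset α) := by
      ext a; simp only [mem_insert, mem_singleton]; tauto
    have h1 := rk_insert_eq hw₁g (insert_subset hxg (singleton_subset_iff.2 hw₂g)) (M := N) (e := w₁)
      (X := insert x {w₂})
    rw [if_neg h, e, hrx12, hrx2] at h1
    omega
  have hw₂cl : w₂ ∈ clF N (insert x {w₁}) := by
    by_contra h
    have e : insert w₂ (insert x ({w₁} : Finset α)) = insert x ({w₁, w₂} : Finset α) := by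
      ext a; simp only [mem_insert, mem_singleton]; tauto
    have h1 := rk_insert_eq hw₂g (insert_subset hxg (singleton_subset_iff.2 hw₁g)) (M := N) (e := w₂)
      (X := insert x {w₁})
    rw [if_neg h, e, hrx12, hrx1] at h1
    omega
  -- the class at every level is `{W ∈ BI_k : w₁, w₂ ∈ W, x ∉ W}`
  have hclass : ∀ k : ℕ, ∀ W ∈ biIndepSets N k,
      ((x ∉ W ∧ x ∈ clF N W ∧ fundC N W x = {w₁, w₂}) ↔ ({w₁, w₂} ⊆ W ∧ x ∉ W)) := by
    intro k W hW
    rw [mem_biIndepSets] at hW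
    obtain ⟨hWg, hWcard, hWrk, hWcompl⟩ := hW
    constructor
    · rintro ⟨hxW, _, hfund⟩
      exact ⟨hfund ▸ fundC_subset W x, hxW⟩
    · rintro ⟨hCW, hxW⟩
      have hxcl : x ∈ clF N W := mem_clF_of_subset hCW hxcl12
      refine ⟨hxW, hxcl, ?_⟩
      have hw₁W : w₁ ∈ W := hCW (mem_insert_self _ _)
      have hw₂W : w₂ ∈ W := hCW (mem_insert_of_mem (mem_singleton_self _))
      -- for `w, v ∈ W`, `v ≠ w`, `w ∈ cl{x, v}`: `x ∉ cl(W − w)`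
      have key : ∀ w v : α, w ∈ W → v ∈ W → v ≠ w → w ∈ clF N (insert x {v}) → x ∉ clF N (W.erase w) := by
        intro w v hwW hvW hvw hwcl hx'
        have hWe : W.erase w ⊆ gr N := (erase_subset w W).trans hWg
        have r1 : rk N (insert x (W.erase w)) = rk N (W.erase w) := by
          rw [rk_insert_eq hxg hWe, if_pos hx']
        have hwcl' : w ∈ clF N (insert x (W.erase w)) :=
          mem_clF_of_subset (insert_subset_insert x (singleton_subset_iff.2 (mem_erase.2 ⟨hvw, hvW⟩))) hwcl
        have r2 : rk N (insert w (insert x (W.erase w))) = rk N (insert x (W.erase w)) := by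
          rw [rk_insert_eq (hWg hwW) ((insert_subset_iff).2 ⟨hxg, hWe⟩), if_pos hwcl']
        have e : insert w (insert x (W.erase w)) = insert x W := by
          ext a
          simp only [mem_insert, mem_erase]
          constructor
          · rintro (rfl | rfl | ⟨_, h⟩)
            · exact Or.inr hwW
            · exact Or.inl rfl
            · exact Or.inr h
          · rintro (rfl | h)
            · exact Or.inr (Or.inl rfl)
            · by_cases haw : a = w
              · exact Or.inl haw
              · exact Or.inr (Or.inr ⟨haw, h⟩)
        have r3 : rk N (insert x W) = rk N W := by rw [rk_insert_eq hxg hWg, if_pos hxcl]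
        have rWe : rk N (W.erase w) = W.card - 1 := by
          rw [rk_eq_card_of_subset_of_rk_eq_card (erase_subset w W) hWrk, card_erase_of_mem hwW]
        have hW1 : 1 ≤ W.card := card_pos.2 ⟨w, hwW⟩
        rw [e, r3, r1, rWe, hWrk] at r2
        omega
      ext w
      unfold fundC
      rw [mem_filter, mem_insert, mem_singleton]
      constructor
      · rintro ⟨hwW, hx'⟩
        by_contra hne
        rw [not_or] at hne
        have hsub : {w₁, w₂} ⊆ W.erase w := by
          intro a ha
          rw [mem_insert, mem_singleton] at ha
          rw [mem_erase]
          rcases ha with rfl | rfl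
          · exact ⟨fun h => hne.1 h.symm, hw₁W⟩
          · exact ⟨fun h => hne.2 h.symm, hw₂W⟩
        exact hx' (mem_clF_of_subset hsub hxcl12)
      · intro hw
        rcases hw with h | h
        · rw [h]
          exact ⟨hw₁W, key w₁ w₂ hw₁W hw₂W hw12.symm hw₁cl⟩
        · rw [h]
          exact ⟨hw₂W, key w₂ w₁ hw₂W hw₁W hw12 hw₂cl⟩
  have hfilt : ∀ k : ℕ, (biIndepSets N k).filter (fun W => x ∉ W ∧ x ∈ clF N W ∧ fundC N W x = {w₁, w₂}) =
      (biIndepSets N k).filter (fun W => {w₁, w₂} ⊆ W ∧ x ∉ W) := by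
    intro k
    apply filter_congr
    intro W hW
    exact hclass k W hW
  rw [hfilt, hfilt]
  -- the matroid `N° := N ／ x ∖ w₁`
  have hgr₀ : gr ((N ／ ({x} : Set α)) ＼ ({w₁} : Set α)) = ((gr N).erase x).erase w₁ := by
    rw [gr_delete', gr_contract']
  have hxind : N.Indep ({x} : Set α) := by
    have hx1 : rk N {x} = 1 := by
      have h := rk_eq_card_of_subset_of_rk_eq_card (singleton_subset_iff.2 (mem_sdiff.2 ⟨hxg, hxW₀⟩)) hW₀compl
      rwa [card_singleton] at h
    have := indep_of_rk_eq_card' (M := N) (X := {x}) (by rw [hx1, card_singleton])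
    simpa using this
  have hrk₀ : ∀ X : Finset α, X ⊆ ((gr N).erase x).erase w₁ →
      rk ((N ／ ({x} : Set α)) ＼ ({w₁} : Set α)) X + 1 = rk N (insert x X) := by
    intro X hX
    have hX' : X ⊆ (gr (N ／ ({x} : Set α))).erase w₁ := by rw [gr_contract']; exact hX
    have hX'' : X ⊆ (gr N).erase x := hX.trans (erase_subset _ _)
    rw [rk_delete hX', rk_contract_add_one hxind hX'']
  have hcard₀ : (((gr N).erase x).erase w₁).card = (gr N).card - 2 := by
    rw [card_erase_of_mem (mem_erase.2 ⟨fun h => hxw₁ h.symm, hw₁g⟩), card_erase_of_mem hxg]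
    omega
  have hrkg₀ : rk ((N ／ ({x} : Set α)) ＼ ({w₁} : Set α)) (((gr N).erase x).erase w₁) = rk N (gr N) - 1 := by
    have h := hrk₀ _ (Subset.refl _)
    have e : insert x (((gr N).erase x).erase w₁) = (gr N).erase w₁ := by
      ext a
      simp only [mem_insert, mem_erase]
      constructor
      · rintro (rfl | ⟨haw, _, hag⟩)
        · exact ⟨hxw₁, hxg⟩
        · exact ⟨haw, hag⟩
      · rintro ⟨haw, hag⟩
        by_cases hax : a = x
        · exact Or.inl hax
        · exact Or.inr ⟨haw, hax, hag⟩
    have hw₁cl' : w₁ ∈ clF N ((gr N).erase w₁) :=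
      mem_clF_of_subset (insert_subset (mem_erase.2 ⟨hxw₁, hxg⟩)
        (singleton_subset_iff.2 (mem_erase.2 ⟨hw12.symm, hw₂g⟩))) hw₁cl
    have h2 : rk N (insert w₁ ((gr N).erase w₁)) = rk N ((gr N).erase w₁) := by
      rw [rk_insert_eq hw₁g (erase_subset w₁ (gr N)), if_pos hw₁cl']
    rw [insert_erase hw₁g] at h2
    rw [e, ← h2] at h
    omega
  -- the bijection `W ↦ W − w₁` onto the `w₂`-containing bi-independent sets of `N°`, at every level `k ≥ 1`
  have hbij : ∀ k : ℕ, 1 ≤ k →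
      ((biIndepSets N k).filter (fun W => {w₁, w₂} ⊆ W ∧ x ∉ W)).card =
        ((biIndepSets ((N ／ ({x} : Set α)) ＼ ({w₁} : Set α)) (k - 1)).filter (fun X => w₂ ∈ X)).card := by
    intro k hk
    apply card_nbij' (fun W => W.erase w₁) (fun X => insert w₁ X)
    · intro W hW
      rw [mem_coe, mem_filter, mem_biIndepSets] at hW
      obtain ⟨⟨hWg, hWcard, hWrk, hWcompl⟩, hCW, hxW⟩ := hW
      have hw₁W : w₁ ∈ W := hCW (mem_insert_self _ _)
      have hw₂W : w₂ ∈ W := hCW (mem_insert_of_mem (mem_singleton_self _))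
      rw [mem_coe, mem_filter, mem_biIndepSets, hgr₀]
      simp only
      have hWeg : W.erase w₁ ⊆ ((gr N).erase x).erase w₁ := by
        intro a ha
        rw [mem_erase] at ha
        exact mem_erase.2 ⟨ha.1, mem_erase.2 ⟨fun h => hxW (h ▸ ha.2), hWg ha.2⟩⟩
      refine ⟨⟨hWeg, ?_, ?_, ?_⟩, mem_erase.2 ⟨hw12.symm, hw₂W⟩⟩
      · rw [card_erase_of_mem hw₁W, hWcard]
      · have h := hrk₀ (W.erase w₁) hWeg
        have hw₁cl'' : w₁ ∈ clF N (insert x (W.erase w₁)) :=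
          mem_clF_of_subset (insert_subset_insert x (singleton_subset_iff.2 (mem_erase.2 ⟨hw12.symm, hw₂W⟩))) hw₁cl
        have r1 : rk N (insert w₁ (insert x (W.erase w₁))) = rk N (insert x (W.erase w₁)) := by
          rw [rk_insert_eq hw₁g (insert_subset hxg ((erase_subset _ _).trans hWg)), if_pos hw₁cl'']
        have e : insert w₁ (insert x (W.erase w₁)) = insert x W := by
          ext a
          simp only [mem_insert, mem_erase]
          constructor
          · rintro (rfl | rfl | ⟨_, h⟩)
            · exact Or.inr hw₁W
            · exact Or.inl rfl
            · exact Or.inr h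
          · rintro (rfl | h)
            · exact Or.inr (Or.inl rfl)
            · by_cases haw : a = w₁
              · exact Or.inl haw
              · exact Or.inr (Or.inr ⟨haw, h⟩)
        have r3 : rk N (insert x W) = rk N W := by
          rw [rk_insert_eq hxg hWg, if_pos (mem_clF_of_subset hCW hxcl12)]
        rw [e, r3, hWrk] at r1
        rw [card_erase_of_mem hw₁W]
        omega
      · have e : ((gr N).erase x).erase w₁ \ W.erase w₁ = (gr N \ W).erase x := by
          ext a
          simp only [mem_sdiff, mem_erase]
          constructor
          · rintro ⟨⟨haw, hax, hag⟩, h⟩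
            exact ⟨hax, hag, fun haW => h ⟨haw, haW⟩⟩
          · rintro ⟨hax, hag, haW⟩
            exact ⟨⟨fun h => haW (h ▸ hw₁W), hax, hag⟩, fun h => haW h.2⟩
        rw [e]
        have hYg : (gr N \ W).erase x ⊆ ((gr N).erase x).erase w₁ := by rw [← e]; exact sdiff_subset
        have h := hrk₀ _ hYg
        have eY : insert x ((gr N \ W).erase x) = gr N \ W := insert_erase (mem_sdiff.2 ⟨hxg, hxW⟩)
        rw [eY, hWcompl] at h
        have : 0 < (gr N \ W).card := card_pos.2 ⟨x, mem_sdiff.2 ⟨hxg, hxW⟩⟩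
        rw [card_erase_of_mem (mem_sdiff.2 ⟨hxg, hxW⟩)]
        omega
    · intro X hX
      rw [mem_coe, mem_filter, mem_biIndepSets, hgr₀] at hX
      obtain ⟨⟨hXg, hXcard, hXrk, hXcompl⟩, hw₂X⟩ := hX
      have hw₁X : w₁ ∉ X := fun h => (mem_erase.1 (hXg h)).1 rfl
      have hxX : x ∉ X := fun h => (mem_erase.1 (mem_erase.1 (hXg h)).2).1 rfl
      have hXg' : X ⊆ gr N := hXg.trans ((erase_subset _ _).trans (erase_subset _ _))
      rw [mem_coe, mem_filter, mem_biIndepSets]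
      simp only
      refine ⟨⟨insert_subset hw₁g hXg', ?_, ?_, ?_⟩, ?_, ?_⟩
      · rw [card_insert_of_notMem hw₁X, hXcard]
        omega
      · have h := hrk₀ X hXg
        rw [hXrk, hXcard] at h
        have hxcl' : x ∈ clF N (insert w₁ X) :=
          mem_clF_of_subset (insert_subset (mem_insert_self _ _)
            (singleton_subset_iff.2 (mem_insert_of_mem hw₂X))) hxcl12
        have hw₁cl' : w₁ ∈ clF N (insert x X) :=
          mem_clF_of_subset (insert_subset (mem_insert_self _ _)
            (singleton_subset_iff.2 (mem_insert_of_mem hw₂X))) hw₁cl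
        have r1 : rk N (insert x (insert w₁ X)) = rk N (insert w₁ X) := by
          rw [rk_insert_eq hxg (insert_subset hw₁g hXg'), if_pos hxcl']
        have r2 : rk N (insert w₁ (insert x X)) = rk N (insert x X) := by
          rw [rk_insert_eq hw₁g (insert_subset hxg hXg'), if_pos hw₁cl']
        have e : insert x (insert w₁ X) = insert w₁ (insert x X) := by
          ext a; simp only [mem_insert]; tauto
        rw [e, r2] at r1
        rw [card_insert_of_notMem hw₁X, ← r1]
        omega
      · have e : gr N \ insert w₁ X = insert x (((gr N).erase x).erase w₁ \ X) := by
          ext a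
          simp only [mem_sdiff, mem_insert, mem_erase, not_or]
          constructor
          · rintro ⟨hag, haw, haX⟩
            by_cases hax : a = x
            · exact Or.inl hax
            · exact Or.inr ⟨⟨haw, hax, hag⟩, haX⟩
          · rintro (rfl | ⟨⟨haw, hax, hag⟩, haX⟩)
            · exact ⟨hxg, hxw₁, hxX⟩
            · exact ⟨hag, haw, haX⟩
        rw [e]
        have hYg : ((gr N).erase x).erase w₁ \ X ⊆ ((gr N).erase x).erase w₁ := sdiff_subset
        have h := hrk₀ _ hYg
        have hxY : x ∉ ((gr N).erase x).erase w₁ \ X :=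
          fun h => (mem_erase.1 (mem_erase.1 (mem_sdiff.1 h).1).2).1 rfl
        rw [hXcompl] at h
        rw [card_insert_of_notMem hxY]
        omega
      · exact insert_subset (mem_insert_self _ _) (singleton_subset_iff.2 (mem_insert_of_mem hw₂X))
      · exact fun h => hxX ((mem_insert.1 h).resolve_left hxw₁)
    · intro W hW
      rw [mem_coe, mem_filter] at hW
      exact insert_erase (hW.2.1 (mem_insert_self _ _))
    · intro X hX
      rw [mem_coe, mem_filter, mem_biIndepSets, hgr₀] at hX
      have hw₁X : w₁ ∉ X := fun h => (mem_erase.1 (hX.1.1 h)).1 rfl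
      exact erase_insert hw₁X
  rw [hbij 5 (by norm_num), hbij ((gr N).card - 6) (by omega)]
  -- the in–out inequality on `N°`
  have hn₀ : (gr ((N ／ ({x} : Set α)) ＼ ({w₁} : Set α))).card =
      rk ((N ／ ({x} : Set α)) ＼ ({w₁} : Set α)) (gr ((N ／ ({x} : Set α)) ＼ ({w₁} : Set α))) + 4 := by
    rw [hgr₀, hcard₀, hrkg₀]
    omega
  have hR₀ : rk ((N ／ ({x} : Set α)) ＼ ({w₁} : Set α)) (gr ((N ／ ({x} : Set α)) ＼ ({w₁} : Set α))) = 6 := by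
    rw [hgr₀, hrkg₀, hR7]
  have hw₂g₀ : w₂ ∈ gr ((N ／ ({x} : Set α)) ＼ ({w₁} : Set α)) := by
    rw [hgr₀]
    exact mem_erase.2 ⟨hw12.symm, mem_erase.2 ⟨fun h => hxw₂ h.symm, hw₂g⟩⟩
  have hio' := inCount_four_le_outCount_five_of_card_ten hn₀ hR₀ hw₂g₀
  have hsym := inCount_sub_eq_outCount (M := (N ／ ({x} : Set α)) ＼ ({w₁} : Set α)) (k := 5) hw₂g₀
    (by rw [hgr₀, hcard₀]; omega)
  rw [hgr₀, hcard₀] at hsym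
  have e1 : (5 : ℕ) - 1 = 4 := by norm_num
  have e2 : (gr N).card - 6 - 1 = (gr N).card - 2 - 5 := by omega
  rw [e1, e2]
  unfold inCount outCount at hio' hsym
  rw [hsym]
  exact hio'

end Twelve

end PercRepro.Cogirth
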